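import Summits.Ventures.Crystal3D.Theorems.StickyWulffConstantCoaxialWallLawAutomatonCount
import Summits.Ventures.Crystal3D.Theorems.StickyWulffConstantCoaxialWallLawExitCountBelow
import HarnessLib

/-!
# The line automaton of the co-axial cell: transmitted ends enter the top window along the SHALLOW slot

HONEST FRAMING. Part of the venture `Summits/Ventures/Crystal3D` (cell `crystal3d-full`), helper for the
crux `CoaxialWallLaw` (stmt-Ventures-19481) of `route-Ventures-StickyWulffConstant`, REGISTERED line
`WallLedgerF` (planner cf-p1 gen 16), open stub `stub_coaxialTwoSlabAdhesion` (general fillings).  Brick 5 of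
the FLUX-GAP architecture (memo F-FLUXGAP-ARCH §2): where the TRANSMITTED ends of the automaton
(`…AutomatonCount`: states whose move reaches the cut `zcut = h + R₀ + 1`) can sit.  This is the geometric
heart of the beam-expansion mechanism.  Rung credit only; F-C1 not moved.

SETTING.  The top sample `P₂` of the grain `Λ₂ = F c_Λ·Λ₀ + t₂` is complete in `[h + R₀, h + 2R₀] × disc ρ`
inside the `1`-separated `X` (all balls below `h + 2R₀`, lateral radius `≤ ρ`), `R₀ ≥ 3`; the designated
vector of class `c_Λ` ON `Λ₂` is the fixed SHALLOW slot `sh` (`hsh`), and the designated vectors of the other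
class are never slot vectors of `F c_Λ` (`hnon`: the two slot sets share only the in-plane slots, and
designated vectors are far slots).

* `trans_end_shape` — a transmitted end whose target is off the rim (lateral radius `≤ ρ − 2`) has its
  target `s ∈ P₂` (sealing), enters it along `sh` (the target carries its twelve `Λ₂`-neighbours, so the
  entering unit vector is a slot of `F c_Λ` — else the predecessor would be a thirteenth contact — hence not
  a designated vector of the other class, hence the designated vector of class `c_Λ` at a `Λ₂`-site: `sh`),
  and therefore `zcut ≤ s₂ < zcut + sh₂`: **the target lies in the shallow band**.
* `card_trans_le` — **#transmitted ends ≤ #(shallow band of `P₂`) + 2 · #(rim balls at heights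
  `[zcut, zcut + 1]`)** (injectivity of the move).

WHAT THIS IS NOT: the band is counted by bond lines in the next file; not the stub; F-C1 not moved.
-/

noncomputable section

namespace Summit.Ventures.Crystal3D.Theorems

open Summit.Ventures.Crystal3D Finset
open Literature.MathematicalPhysics.StatisticalMechanics (fccStacking)
open scoped InnerProductSpace

section Trans

open scoped Classical

variable {X P' P₂ : Finset (EuclideanSpace ℝ (Fin 3))} {V : Finset (EuclideanSpace ℝ (Fin 3) × Bool)}
  {F : Bool → (EuclideanSpace ℝ (Fin 3) ≃ₗᵢ[ℝ] EuclideanSpace ℝ (Fin 3))} {m t₂ sh : EuclideanSpace ℝ (Fin 3)}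
  {dsg : Bool → EuclideanSpace ℝ (Fin 3) → EuclideanSpace ℝ (Fin 3)}
  {f : EuclideanSpace ℝ (Fin 3) × Bool → EuclideanSpace ℝ (Fin 3) × Bool}
  {Full TD Inv : Bool → EuclideanSpace ℝ (Fin 3) → Prop} {zlo zcut h R₀ ρ : ℝ} {cΛ : Bool}

set_option maxHeartbeats 400000 in
/-- **Shape of a transmitted end off the rim.**  See the module docstring. -/
theorem trans_end_shape (hX : ∀ p ∈ X, ∀ q ∈ X, p ≠ q → 1 ≤ dist p q) (hm : ‖m‖ = 1)
    (hmenu : ∀ c, ∀ w ∈ fccSlots,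
      ⟪F c w, m⟫_ℝ = 0 ∨ ⟪F c w, m⟫_ℝ = Real.sqrt (2 / 3) ∨ ⟪F c w, m⟫_ℝ = -Real.sqrt (2 / 3))
    (hmir : ∀ c, ∀ w ∈ fccSlots, ∃ w' ∈ fccSlots, F (!c) w' = F c w - (2 * ⟪F c w, m⟫_ℝ) • m)
    (hFull : ∀ c b, Full c b ↔ ∀ w ∈ fccSlots, b + F c w ∈ X)
    (hTD : ∀ c b, TD c b ↔
      ((∀ w ∈ fccSlots, ⟪F c w, m⟫_ℝ ≤ 0 → b + F c w ∈ X) ∧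
       (∀ w ∈ fccSlots, ⟪F c w, m⟫_ℝ < 0 → b + (F c w - (2 * ⟪F c w, m⟫_ℝ) • m) ∈ X) ∧
       (∀ w ∈ fccSlots, 0 < ⟪F c w, m⟫_ℝ → b + F c w ∉ X)))
    (hInv : ∀ c b, Inv c b ↔ ∃ a ∈ fccSlots, ∃ a' ∈ fccSlots, ∃ a'' ∈ fccSlots,
      LinearIndependent ℝ ![a, a', a''] ∧ b + F c a ∈ X ∧ b + F c a' ∈ X ∧ b + F c a'' ∈ X)
    (hdsg_up : ∀ c b, ∃ u ∈ fccSlots, ⟪F c u, m⟫_ℝ = Real.sqrt (2 / 3) ∧ dsg c b = F c u)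
    (hdsg_inv : ∀ c b, ∀ w ∈ fccStacking 1 (Real.sqrt (2 / 3)), dsg c (b + F c w) = dsg c b)
    (hrise : ∀ c b, 0 < dsg c b 2)
    (hf : ∀ v, f v = if Full v.2 v.1 then (v.1 + dsg v.2 v.1, v.2) else (v.1 + dsg (!v.2) v.1, !v.2))
    (hV : ∀ v, v ∈ V ↔ (v.1 ∈ X ∧ zlo ≤ v.1 2 ∧ v.1 2 < zcut ∧ v.1 ∉ P' ∧ Inv v.2 v.1 ∧
      ∃ w ∈ fccSlots, ⟪F v.2 w, m⟫_ℝ < 0 ∧ v.1 + F v.2 w ∈ X))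
    (hP' : ∀ p ∈ P', p 2 ≤ zlo)
    (hR₀ : 3 ≤ R₀) (hρ : R₀ ≤ ρ) (hzcut : zcut = h + R₀ + 1)
    (hcell : ∀ p ∈ X, p 2 ≤ h + 2 * R₀ ∧ p 0 ^ 2 + p 1 ^ 2 ≤ ρ ^ 2) (hP₂X : P₂ ⊆ X)
    (hP₂ : ∀ p, p ∈ P₂ ↔ (p ∈ (fun q => F cΛ q + t₂) '' fccStacking 1 (Real.sqrt (2 / 3)) ∧
      h + R₀ ≤ p 2 ∧ p 2 ≤ h + 2 * R₀ ∧ p 0 ^ 2 + p 1 ^ 2 ≤ ρ ^ 2))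
    (hsh : ∀ b ∈ (fun q => F cΛ q + t₂) '' fccStacking 1 (Real.sqrt (2 / 3)), dsg cΛ b = sh)
    (hnon : ∀ b, ∀ w ∈ fccSlots, dsg (!cΛ) b ≠ F cΛ w)
    {v : EuclideanSpace ℝ (Fin 3) × Bool} (hv : v ∈ V) (hmove : Full v.2 v.1 ∨ TD v.2 v.1)
    (hcut : zcut ≤ (f v).1 2) (hlat : (f v).1 0 ^ 2 + (f v).1 1 ^ 2 ≤ (ρ - 2) ^ 2) :
    (f v).2 = cΛ ∧ (f v).1 ∈ P₂ ∧ (f v).1 = v.1 + sh ∧ (f v).1 2 < zcut + sh 2 := by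
  have hρ1 : (1 : ℝ) ≤ ρ := by linarith
  obtain ⟨hbX, -, hbcut, -, -, -⟩ := (hV v).1 hv
  have hcl := move_target hm hmenu hmir hFull hTD hInv hdsg_up hdsg_inv hrise hf hV hP' hv hmove
  obtain ⟨hsX, hlt, -, -, -⟩ := hcl
  -- names for the target
  obtain ⟨s, c', hsc⟩ : ∃ s c', f v = (s, c') := ⟨(f v).1, (f v).2, rfl⟩
  rw [hsc] at hsX hlt hcut hlat ⊢
  simp only at hsX hlt hcut hlat ⊢
  have hball : v.1 = s - dsg c' s := move_ball_eq hdsg_up hdsg_inv hf hsc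
  obtain ⟨u, hu, hun, hde⟩ := hdsg_up c' s
  -- height of the target: below `zcut + 1`
  have hd2 : dsg c' s 2 ≤ 1 := by
    rw [hde, apply_two_eq_inner_e₃]; exact (abs_le.1 (abs_inner_slot_le_one (F c') hu)).2
  have hs2 : s 2 < zcut + 1 := by
    have : s 2 = v.1 2 + dsg c' s 2 := by rw [hball, PiLp.sub_apply]; ring
    linarith
  -- (1) the target is a ball of the top sample (sealing)
  have hsP₂ : s ∈ P₂ := by
    by_contra hns
    refine sealing_above (F cΛ) t₂ (h + R₀) (h + 2 * R₀) ρ hρ1 X P₂ hX hP₂X hP₂ s hsX hns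
      (by linarith) (hcell s hsX).1 ?_
    nlinarith [hlat]
  have hsΛ : s ∈ (fun q => F cΛ q + t₂) '' fccStacking 1 (Real.sqrt (2 / 3)) := ((hP₂ s).1 hsP₂).1
  -- (2) its twelve `Λ₂`-slots are balls of `P₂`
  have hnb : ∀ w ∈ fccSlots, s + F cΛ w ∈ X := by
    intro w hw
    apply hP₂X
    rw [hP₂]
    have hw2 : |(F cΛ w) 2| ≤ 1 := by rw [apply_two_eq_inner_e₃]; exact abs_inner_slot_le_one (F cΛ) hw
    obtain ⟨hw2a, hw2b⟩ := abs_le.1 hw2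
    refine ⟨movedFcc_add_site_mem (F cΛ) t₂ hsΛ (mem_fcc_of_mem_fccSlots hw), ?_, ?_, ?_⟩
    · rw [PiLp.add_apply]; linarith
    · rw [PiLp.add_apply]; linarith
    · have hρ2 : (0 : ℝ) ≤ ρ - 2 := by linarith
      have hsl : Real.sqrt (s 0 ^ 2 + s 1 ^ 2) ≤ ρ - 2 := by
        rw [← Real.sqrt_sq hρ2]; exact Real.sqrt_le_sqrt hlat
      have h1 := sqrt_lateral_add_le s (F cΛ w)
      rw [LinearIsometryEquiv.norm_map, norm_eq_one_of_mem_fccSlots hw] at h1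
      have h3 : Real.sqrt ((s + F cΛ w) 0 ^ 2 + (s + F cΛ w) 1 ^ 2) ≤ ρ := by linarith
      have h4 := Real.sq_sqrt (by positivity : (0 : ℝ) ≤ (s + F cΛ w) 0 ^ 2 + (s + F cΛ w) 1 ^ 2)
      have h5 : (0 : ℝ) ≤ Real.sqrt ((s + F cΛ w) 0 ^ 2 + (s + F cΛ w) 1 ^ 2) := Real.sqrt_nonneg _
      nlinarith
  -- (3) the entering vector is a slot of `F cΛ` (else thirteen contacts at `s`)
  have hslot : ∃ w ∈ fccSlots, F cΛ w = -dsg c' s := by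
    by_contra hno
    push Not at hno
    have hcard : (insert v.1 (fccSlots.image fun w => s + F cΛ w)).card = 13 := by
      rw [card_insert_of_notMem, card_image_of_injective, card_fccSlots]
      · intro w₁ w₂ hw
        exact (F cΛ).injective (add_left_cancel hw)
      · intro hmem
        obtain ⟨w, hw, hwe⟩ := mem_image.1 hmem
        apply hno w hw
        rw [hball] at hwe
        have : F cΛ w = -dsg c' s := by
          have := hwe; rw [sub_eq_add_neg] at this; exact add_left_cancel this
        exact this
    have hsub : insert v.1 (fccSlots.image fun w => s + F cΛ w) ⊆ X.filter fun q => dist s q = 1 := by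
      intro q hq
      rw [mem_filter]
      rcases mem_insert.1 hq with rfl | hq'
      · refine ⟨hbX, ?_⟩
        rw [hball, dist_eq_norm, sub_sub_cancel, hde, LinearIsometryEquiv.norm_map,
          norm_eq_one_of_mem_fccSlots hu]
      · obtain ⟨w, hw, rfl⟩ := mem_image.1 hq'
        refine ⟨hnb w hw, ?_⟩
        rw [dist_eq_norm, sub_add_cancel_left, norm_neg, LinearIsometryEquiv.norm_map,
          norm_eq_one_of_mem_fccSlots hw]
    have h12 := card_filter_dist_eq_one_le_twelve X hX s
    have := card_le_card hsub
    omega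
  obtain ⟨w, hw, hwe⟩ := hslot
  -- (4) so the class of the target is `cΛ` …
  have hc' : c' = cΛ := by
    by_contra hne
    have hc'' : c' = !cΛ := by
      cases c' <;> cases cΛ <;> simp_all
    have key := hnon s (-w) (neg_mem_fccSlots hw)
    rw [← hc'', map_neg, hwe, neg_neg] at key
    exact key rfl
  subst hc'
  -- (5) … and the entering vector is the shallow slot
  have hdsh : dsg c' s = sh := hsh s hsΛ
  have hs : s = v.1 + sh := by rw [hball, hdsh, sub_add_cancel]
  refine ⟨rfl, hsP₂, hs, ?_⟩
  have : s 2 = v.1 2 + sh 2 := by rw [hs, PiLp.add_apply]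
  linarith

/-- **Counting the transmitted ends.**  See the module docstring. -/
theorem card_trans_le (hX : ∀ p ∈ X, ∀ q ∈ X, p ≠ q → 1 ≤ dist p q) (hm : ‖m‖ = 1)
    (hmenu : ∀ c, ∀ w ∈ fccSlots,
      ⟪F c w, m⟫_ℝ = 0 ∨ ⟪F c w, m⟫_ℝ = Real.sqrt (2 / 3) ∨ ⟪F c w, m⟫_ℝ = -Real.sqrt (2 / 3))
    (hmir : ∀ c, ∀ w ∈ fccSlots, ∃ w' ∈ fccSlots, F (!c) w' = F c w - (2 * ⟪F c w, m⟫_ℝ) • m)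
    (hFull : ∀ c b, Full c b ↔ ∀ w ∈ fccSlots, b + F c w ∈ X)
    (hTD : ∀ c b, TD c b ↔
      ((∀ w ∈ fccSlots, ⟪F c w, m⟫_ℝ ≤ 0 → b + F c w ∈ X) ∧
       (∀ w ∈ fccSlots, ⟪F c w, m⟫_ℝ < 0 → b + (F c w - (2 * ⟪F c w, m⟫_ℝ) • m) ∈ X) ∧
       (∀ w ∈ fccSlots, 0 < ⟪F c w, m⟫_ℝ → b + F c w ∉ X)))
    (hInv : ∀ c b, Inv c b ↔ ∃ a ∈ fccSlots, ∃ a' ∈ fccSlots, ∃ a'' ∈ fccSlots,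
      LinearIndependent ℝ ![a, a', a''] ∧ b + F c a ∈ X ∧ b + F c a' ∈ X ∧ b + F c a'' ∈ X)
    (hdsg_up : ∀ c b, ∃ u ∈ fccSlots, ⟪F c u, m⟫_ℝ = Real.sqrt (2 / 3) ∧ dsg c b = F c u)
    (hdsg_inv : ∀ c b, ∀ w ∈ fccStacking 1 (Real.sqrt (2 / 3)), dsg c (b + F c w) = dsg c b)
    (hrise : ∀ c b, 0 < dsg c b 2)
    (hf : ∀ v, f v = if Full v.2 v.1 then (v.1 + dsg v.2 v.1, v.2) else (v.1 + dsg (!v.2) v.1, !v.2))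
    (hV : ∀ v, v ∈ V ↔ (v.1 ∈ X ∧ zlo ≤ v.1 2 ∧ v.1 2 < zcut ∧ v.1 ∉ P' ∧ Inv v.2 v.1 ∧
      ∃ w ∈ fccSlots, ⟪F v.2 w, m⟫_ℝ < 0 ∧ v.1 + F v.2 w ∈ X))
    (hP' : ∀ p ∈ P', p 2 ≤ zlo)
    (hR₀ : 3 ≤ R₀) (hρ : R₀ ≤ ρ) (hzcut : zcut = h + R₀ + 1)
    (hcell : ∀ p ∈ X, p 2 ≤ h + 2 * R₀ ∧ p 0 ^ 2 + p 1 ^ 2 ≤ ρ ^ 2) (hP₂X : P₂ ⊆ X)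
    (hP₂ : ∀ p, p ∈ P₂ ↔ (p ∈ (fun q => F cΛ q + t₂) '' fccStacking 1 (Real.sqrt (2 / 3)) ∧
      h + R₀ ≤ p 2 ∧ p 2 ≤ h + 2 * R₀ ∧ p 0 ^ 2 + p 1 ^ 2 ≤ ρ ^ 2))
    (hsh : ∀ b ∈ (fun q => F cΛ q + t₂) '' fccStacking 1 (Real.sqrt (2 / 3)), dsg cΛ b = sh)
    (hnon : ∀ b, ∀ w ∈ fccSlots, dsg (!cΛ) b ≠ F cΛ w) :
    (V.filter fun v => (Full v.2 v.1 ∨ TD v.2 v.1) ∧ zcut ≤ (f v).1 2).card ≤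
      (P₂.filter fun s => zcut ≤ s 2 ∧ s 2 < zcut + sh 2).card +
        2 * (X.filter fun s => zcut ≤ s 2 ∧ s 2 ≤ zcut + 1 ∧ (ρ - 2) ^ 2 < s 0 ^ 2 + s 1 ^ 2).card := by
  set TR := V.filter fun v => (Full v.2 v.1 ∨ TD v.2 v.1) ∧ zcut ≤ (f v).1 2 with hTR
  set T₁ := TR.filter fun v => (f v).1 0 ^ 2 + (f v).1 1 ^ 2 ≤ (ρ - 2) ^ 2 with hT₁
  set T₂ := TR.filter fun v => ¬ (f v).1 0 ^ 2 + (f v).1 1 ^ 2 ≤ (ρ - 2) ^ 2 with hT₂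
  set BAND := P₂.filter fun s => zcut ≤ s 2 ∧ s 2 < zcut + sh 2 with hBAND
  set RIMT := X.filter fun s => zcut ≤ s 2 ∧ s 2 ≤ zcut + 1 ∧ (ρ - 2) ^ 2 < s 0 ^ 2 + s 1 ^ 2 with hRIMT
  have hinj : Set.InjOn f {v | Full v.2 v.1 ∨ TD v.2 v.1} := by
    have hfe : f = fun v : EuclideanSpace ℝ (Fin 3) × Bool =>
        if Full v.2 v.1 then (v.1 + dsg v.2 v.1, v.2) else (v.1 + dsg (!v.2) v.1, !v.2) := funext hf
    rw [hfe]; exact move_injOn hX hm hmenu hmir hFull hTD hdsg_up hdsg_inv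
  have hsplit : TR.card = T₁.card + T₂.card := by
    rw [hT₁, hT₂]; exact (Finset.card_filter_add_card_filter_not _).symm
  -- off the rim: inject the TARGET into the band
  have h₁ : T₁.card ≤ BAND.card := by
    refine Finset.card_le_card_of_injOn (fun v => (f v).1) ?_ ?_
    · intro v hv
      rw [Finset.mem_coe, hT₁, mem_filter, hTR, mem_filter] at hv
      obtain ⟨⟨hvV, hmove, hcut⟩, hlat⟩ := hv
      obtain ⟨-, hsP₂, -, hs2⟩ := trans_end_shape hX hm hmenu hmir hFull hTD hInv hdsg_up hdsg_inv hrise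
        hf hV hP' hR₀ hρ hzcut hcell hP₂X hP₂ hsh hnon hvV hmove hcut hlat
      rw [Finset.mem_coe, hBAND, mem_filter]
      exact ⟨hsP₂, hcut, hs2⟩
    · intro v hv v' hv' heq
      rw [Finset.mem_coe, hT₁, mem_filter, hTR, mem_filter] at hv hv'
      obtain ⟨⟨hvV, hmove, hcut⟩, hlat⟩ := hv
      obtain ⟨⟨hvV', hmove', hcut'⟩, hlat'⟩ := hv'
      obtain ⟨hc, -⟩ := trans_end_shape hX hm hmenu hmir hFull hTD hInv hdsg_up hdsg_inv hrise
        hf hV hP' hR₀ hρ hzcut hcell hP₂X hP₂ hsh hnon hvV hmove hcut hlat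
      obtain ⟨hc', -⟩ := trans_end_shape hX hm hmenu hmir hFull hTD hInv hdsg_up hdsg_inv hrise
        hf hV hP' hR₀ hρ hzcut hcell hP₂X hP₂ hsh hnon hvV' hmove' hcut' hlat'
      have hfeq : f v = f v' := Prod.ext heq (by rw [hc, hc'])
      exact hinj hmove hmove' hfeq
  -- on the rim: inject the target STATE into `RIMT × Bool`
  have h₂ : T₂.card ≤ 2 * RIMT.card := by
    have hle : T₂.card ≤ (RIMT ×ˢ (univ : Finset Bool)).card := by
      refine Finset.card_le_card_of_injOn f ?_ ?_
      · intro v hv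
        rw [Finset.mem_coe, hT₂, mem_filter, hTR, mem_filter] at hv
        obtain ⟨⟨hvV, hmove, hcut⟩, hlat⟩ := hv
        push Not at hlat
        obtain ⟨-, -, hbcut, -, -, -⟩ := (hV v).1 hvV
        have hcl := move_target hm hmenu hmir hFull hTD hInv hdsg_up hdsg_inv hrise hf hV hP' hvV hmove
        obtain ⟨hsX, -, -, -, -⟩ := hcl
        have hball : v.1 = (f v).1 - dsg (f v).2 (f v).1 :=
          move_ball_eq hdsg_up hdsg_inv hf (Prod.ext rfl rfl)
        obtain ⟨u, hu, -, hde⟩ := hdsg_up (f v).2 (f v).1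
        have hd2 : dsg (f v).2 (f v).1 2 ≤ 1 := by
          rw [hde, apply_two_eq_inner_e₃]; exact (abs_le.1 (abs_inner_slot_le_one (F (f v).2) hu)).2
        have hs2 : (f v).1 2 ≤ zcut + 1 := by
          have : (f v).1 2 = v.1 2 + dsg (f v).2 (f v).1 2 := by rw [hball, PiLp.sub_apply]; ring
          linarith
        rw [Finset.mem_coe, mem_product, hRIMT, mem_filter]
        exact ⟨⟨hsX, hcut, hs2, hlat⟩, mem_univ _⟩
      · intro v hv v' hv' heq
        rw [Finset.mem_coe, hT₂, mem_filter, hTR, mem_filter] at hv hv'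
        exact hinj hv.1.2.1 hv'.1.2.1 heq
    rw [card_product, card_univ, Fintype.card_bool] at hle
    omega
  omega

end Trans

end Summit.Ventures.Crystal3D.Theorems

end
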